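import Mathlib
import HarnessLib
import Literature.Analysis.FluidPDE.VectorCalculus
import Literature.Analysis.FluidPDE.AxisymmetricEuler
import Literature.Analysis.FluidPDE.SwirlTransportProofs
import Literature.Analysis.FluidPDE.AxisymmetricVorticityTransport
import Literature.Analysis.FluidPDE.CurlIsometryCovariance
import Literature.Analysis.FluidPDE.IsometryInvariance
import Literature.Analysis.FluidPDE.FlatSwirlGauge
import Literature.Analysis.FluidPDE.EulerTimeScaling
import Literature.Analysis.FluidPDE.VorticityCalculus
import Summits.NavierStokesRegularity.NavierStokesRegularity.Theorems.SymmetryModuliCountAxisymEndLiouvilleStubAxisNormalForm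
import Summits.NavierStokesRegularity.NavierStokesRegularity.Theorems.UnthreadedRigidityDoorUnthreadedRigidityProfileHornZonalAxis
import Summits.NavierStokesRegularity.NavierStokesRegularity.Theorems.UnthreadedRigidityDoorUnthreadedRigidityVirialHornAnalyticWedge

/-!
# Route `UnthreadedRigidityDoor`, item `UnthreadedRigidity` (W2, stmt-NavierStokesRegularity-27585) — LINE g11-1 «VIRIAL HORN»:
# S-Z `ZonalShellAxisym` BY NAME — a shell `curl curl (H(|y|) Y(y) y)` with `Y` zonal about `a` is an axisymmetric slice about `x₀`

Prover file (W2 Lean hand ns-crc-p1 g7, DIRECTOR-NS KEY-NS #188 (1); `--supports stmt-NavierStokesRegularity-27585 --as helper`) for LINE g11-1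
«VIRIAL HORN» of planner ns-idea-6 g11 (idea-crit-4 g7 PASS, RUNG line, 2026-08-29T03:44Z; sketch sha16 046ceb385f972470; objects BY NAME in
`Theorems/UnthreadedRigidityDoorUnthreadedRigidityVirialHornDefs.lean`).  NOT the `l = 2` statement S-Z of g10-2 under another name
(`ProfileHorn.zonalSepShellAxisymUniform_holds` takes a zonal FORM `Q`; here the degree is arbitrary and zonality is the infinitesimal condition
`det[a, y, ∇Y(y)] = 0`) — but the same mechanism, whose landed lemmas are reused by name (`ProfileHorn.exists_isometry_map_single_two`,
`rotZ_single_two'`, `inner_rotGen_self_zero`; `VirialHorn.IsSolidHarmonic.contDiff`; `AbsorbingAxisSwirlExtinction.hasDerivAt_rotZ_rotGen`).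

`zonalShellAxisym_holds : ZonalShellAxisym`.  Proof: `n = a/‖a‖`, a Householder isometry `P` with `P e₂ = n`.  The determinant is multiplicative,
`det[Qu, Qv, Qw] = det[Qe₀, Qe₁, Qe₂] · det[u, v, w]` for every linear `Q` (a polynomial identity), and `⟪g, J z⟫ = det[e₂, z, g]`; hence
`⟪∇Y(x), P J P⁻¹ x⟫ = ⟪P⁻¹∇Y(x), J P⁻¹x⟫ = det[P⁻¹ n, P⁻¹ x, P⁻¹ ∇Y(x)]/… ∝ det[a, x, ∇Y(x)] = 0`: the derivative of `θ ↦ Y(P R_θ P⁻¹ y)`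
vanishes, so `Ỹ = Y ∘ P` is `IsAxisymmetricScalar` and `z ↦ (h(‖z‖²) Ỹ(z)) z = P⁻¹ G₀ (P z)` is `IsAxisymmetric` in the tree's sense; its double
curl is `P⁻¹ ∘ curl curl G₀ ∘ P` (`curl_conj_linearIsometryEquiv` twice, `det² = 1`) and `IsAxisymmetric`; `IsAxisymmetric.fderiv_rotGen` is the
infinitesimal identity, transported back by `fderiv_conj_linearIsometryEquiv` and re-centred by `curl_comp_add_const`; the generator is
`A = P ∘ rotGenL ∘ P⁻¹`.

HONEST LABEL: rotation bookkeeping about SPECIAL separable data (support S-Z of a RUNG line); `UnthreadedRigidity` (27585), W2 and NS regularity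
remain OPEN; nothing here is a statement about the Navier–Stokes equations.  0 kit.
-/

-- the summit and its single sub-problem share the name (CONVENTIONS §1), as in every Theorems file
set_option linter.dupNamespace false

namespace Summit.NavierStokesRegularity.NavierStokesRegularity.Theorems.UnthreadedRigidity.VirialHorn

open scoped Topology ContDiff InnerProductSpace
open Filter Set
open Literature.Analysis.FluidPDE
open Summit.NavierStokesRegularity.NavierStokesRegularity.Theorems.UnthreadedRigidity.ProfileHorn (E3 exists_isometry_map_single_two rotZ_single_two' inner_rotGen_self_zero)
open Summit.NavierStokesRegularity.NavierStokesRegularity.Theorems.AxisymEndLiouville.AbsorbingAxisSwirlExtinction (hasDerivAt_rotZ_rotGen)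

/-! ## Determinant bookkeeping -/

/-- a linear map in coordinates: `(Q u)ᵢ = Σⱼ uⱼ (Q eⱼ)ᵢ`. -/
theorem clm_apply_coord (Q : E3 →L[ℝ] E3) (u : E3) (i : Fin 3) :
    Q u i = u 0 * Q (e 0) i + u 1 * Q (e 1) i + u 2 * Q (e 2) i := by
  -- `u` in the standard basis (the tree has this as `…LegendrianDarboux.DarbouxData.eq_sum_smul_e`; inlined here)
  have hu : u = u 0 • e 0 + u 1 • e 1 + u 2 • e 2 := by
    ext j
    fin_cases j <;> simp [e]
  conv_lhs => rw [hu]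
  simp only [map_add, map_smul, PiLp.add_apply, PiLp.smul_apply, smul_eq_mul]

/-- MULTIPLICATIVITY: `det[Qu, Qv, Qw] = det[Qe₀, Qe₁, Qe₂] · det[u, v, w]` for every linear `Q` (a polynomial identity). -/
theorem det3_map (Q : E3 →L[ℝ] E3) (u v w : E3) :
    det3 (Q u) (Q v) (Q w) = det3 (Q (e 0)) (Q (e 1)) (Q (e 2)) * det3 u v w := by
  simp only [det3, clm_apply_coord Q u, clm_apply_coord Q v, clm_apply_coord Q w]
  ring

/-- `det3` is homogeneous in its first slot. -/
theorem det3_smul_left (c : ℝ) (u v w : E3) : det3 (c • u) v w = c * det3 u v w := by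
  simp only [det3, PiLp.smul_apply, smul_eq_mul]
  ring

/-- `⟪g, J z⟫ = det[e₂, z, g]` for the rotation generator `J`. -/
theorem inner_rotGen_eq_det3 (g z : E3) : ⟪g, rotGen z⟫_ℝ = det3 (e 2) z g := by
  rw [Literature.Geometry.Lorentzian.Kerr.Ingoing.inner_e3]
  simp only [rotGen_apply_zero, rotGen_apply_one, rotGen_apply_two, det3, e]
  simp
  ring

/-! ## S-Z -/

/-- **S-Z `ZonalShellAxisym` BY NAME** (support S–M of LINE g11-1). -/
theorem zonalShellAxisym_holds : ZonalShellAxisym := by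
  intro l H Y x₀ hY hzon hAdm
  obtain ⟨a, ha, hza⟩ := hzon
  obtain ⟨⟨h, hh, hHh⟩, -⟩ := hAdm
  have hYs : ContDiff ℝ ∞ Y := hY.contDiff
  have hYd : Differentiable ℝ Y := hYs.differentiable (by simp)
  -- the axis and a Householder isometry
  have han : ‖a‖ ≠ 0 := norm_ne_zero_iff.mpr ha
  set n : E3 := ‖a‖⁻¹ • a with hn_def
  have hn : ‖n‖ = 1 := by rw [hn_def, norm_smul, norm_inv, norm_norm, inv_mul_cancel₀ han]
  obtain ⟨P, hP⟩ := exists_isometry_map_single_two n hn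
  have hP' : P (e 2) = n := by simpa [e] using hP
  have hPsymm : P.symm n = e 2 := by rw [← hP', LinearIsometryEquiv.symm_apply_apply]
  -- KEY: the derivative of `Y` along the conjugated generator vanishes
  have hkey : ∀ x : E3, fderiv ℝ Y x (P (rotGen (P.symm x))) = 0 := by
    intro x
    rw [← inner_gradient_left]
    have e1 : ⟪gradient Y x, P (rotGen (P.symm x))⟫_ℝ = ⟪P.symm (gradient Y x), rotGen (P.symm x)⟫_ℝ := by
      conv_lhs => rw [← P.apply_symm_apply (gradient Y x)]
      rw [LinearIsometryEquiv.inner_map_map]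
    rw [e1, inner_rotGen_eq_det3, ← hPsymm, hn_def, map_smul, det3_smul_left]
    have e2 : det3 (P.symm a) (P.symm x) (P.symm (gradient Y x))
        = det3 ((P.symm : E3 →L[ℝ] E3) (e 0)) ((P.symm : E3 →L[ℝ] E3) (e 1)) ((P.symm : E3 →L[ℝ] E3) (e 2))
          * det3 a x (gradient Y x) := det3_map (P.symm : E3 →L[ℝ] E3) a x (gradient Y x)
    rw [e2, hza x, mul_zero, mul_zero]
  -- `Y ∘ P` is an axisymmetric scalar in the tree's sense
  have hYax : IsAxisymmetricScalar (fun z : E3 => Y (P z)) := by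
    intro θ z
    have hdiff : Differentiable ℝ (fun θ : ℝ => Y (P (rotZ θ z))) := by
      intro θ
      exact ((hYd _).comp _ ((P : E3 →L[ℝ] E3).differentiableAt.comp _ (hasDerivAt_rotZ_rotGen z θ).differentiableAt))
    have hder : ∀ θ : ℝ, deriv (fun θ : ℝ => Y (P (rotZ θ z))) θ = 0 := by
      intro θ
      have h1 : HasDerivAt (fun θ : ℝ => P (rotZ θ z)) (P (rotGen (rotZ θ z))) θ :=
        (P : E3 →L[ℝ] E3).hasFDerivAt.comp_hasDerivAt θ (hasDerivAt_rotZ_rotGen z θ)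
      have h2 : HasDerivAt (fun θ : ℝ => Y (P (rotZ θ z))) (fderiv ℝ Y (P (rotZ θ z)) (P (rotGen (rotZ θ z)))) θ :=
        (hYd _).hasFDerivAt.comp_hasDerivAt θ h1
      rw [h2.deriv]
      have := hkey (P (rotZ θ z))
      rwa [LinearIsometryEquiv.symm_apply_apply] at this
    have := is_const_of_deriv_eq_zero hdiff hder θ 0
    simpa using this
  -- the conjugated potential field is axisymmetric
  set G₀ : E3 → E3 := fun y => (h (‖y‖ ^ 2) * Y y) • y with hG₀
  have hG₀s : ContDiff ℝ ∞ G₀ := by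
    have h1 : ContDiff ℝ ∞ (fun y : E3 => ‖y‖ ^ 2) := contDiff_norm_sq ℝ
    exact ((hh.comp h1).mul hYs).smul contDiff_id
  set Gt : E3 → E3 := fun z => P.symm (G₀ (P z)) with hGt
  have hGt_eq : ∀ z, Gt z = (h (‖z‖ ^ 2) * Y (P z)) • z := by
    intro z
    simp only [hGt, hG₀, map_smul, LinearIsometryEquiv.norm_map, LinearIsometryEquiv.symm_apply_apply]
  have hGt_ax : IsAxisymmetric Gt := by
    intro θ z
    have hY' : Y (P (rotZ θ z)) = Y (P z) := hYax θ z
    rw [hGt_eq, hGt_eq, norm_rotZ, hY', ← rotZLIE_apply θ ((h (‖z‖ ^ 2) * Y (P z)) • z), map_smul, rotZLIE_apply]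
  have hGts : ContDiff ℝ ∞ Gt := by
    simp only [hGt]
    exact (P.symm : E3 →L[ℝ] E3).contDiff.comp (hG₀s.comp (P : E3 →L[ℝ] E3).contDiff)
  have hGtd : Differentiable ℝ Gt := hGts.differentiable (by simp)
  have hcGt : ContDiff ℝ ∞ (curl Gt) := contDiff_curl (n := ⊤) (by simpa using hGts)
  have hcGtd : Differentiable ℝ (curl Gt) := hcGt.differentiable (by simp)
  have hccGt : ContDiff ℝ ∞ (curl (curl Gt)) := contDiff_curl (n := ⊤) (by simpa using hcGt)
  have hccGtd : Differentiable ℝ (curl (curl Gt)) := hccGt.differentiable (by simp)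
  have hax2 : IsAxisymmetric (curl (curl Gt)) := (hGt_ax.curl hGtd).curl hcGtd
  -- conjugation covariance of the double curl
  have hdet := det_linearIsometryEquiv_mul_self P.symm
  have hcurl1 : curl Gt = fun z => (P.symm : E3 →L[ℝ] E3).det • P.symm (curl G₀ (P z)) := by
    funext z
    have := curl_conj_linearIsometryEquiv P.symm G₀ z
    simp only [LinearIsometryEquiv.symm_symm] at this
    simpa [hGt] using this
  have hcurl2 : curl (curl Gt) = fun z => P.symm (curl (curl G₀) (P z)) := by
    funext z
    rw [hcurl1]
    have e1 : (fun z => (P.symm : E3 →L[ℝ] E3).det • P.symm (curl G₀ (P z)))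
        = fun z => P.symm (((P.symm : E3 →L[ℝ] E3).det • curl G₀) (P z)) := by
      funext w; simp [map_smul]
    rw [e1]
    have := curl_conj_linearIsometryEquiv P.symm ((P.symm : E3 →L[ℝ] E3).det • curl G₀) z
    simp only [LinearIsometryEquiv.symm_symm] at this
    rw [this]
    have e2 : curl ((P.symm : E3 →L[ℝ] E3).det • curl G₀) (P z) = (P.symm : E3 →L[ℝ] E3).det • curl (curl G₀) (P z) := by
      have := curl_const_smul_field ((P.symm : E3 →L[ℝ] E3).det) (curl G₀) (P z)
      simpa [Pi.smul_def] using this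
    rw [e2, map_smul, smul_smul, hdet, one_smul]
  -- the infinitesimal identity for `v₀ = curl curl G₀`
  set v₀ : E3 → E3 := curl (curl G₀) with hv₀
  have hinf : ∀ y : E3, fderiv ℝ v₀ y (P (rotGen (P.symm y))) = P (rotGen (P.symm (v₀ y))) := by
    intro y
    have h1 := hax2.fderiv_rotGen (x := P.symm y) (hccGtd _)
    rw [hcurl2] at h1
    have h3 := fderiv_conj_linearIsometryEquiv P.symm v₀ (P.symm y)
    simp only [LinearIsometryEquiv.symm_symm, LinearIsometryEquiv.apply_symm_apply] at h3
    rw [h3] at h1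
    simp only [ContinuousLinearMap.comp_apply, LinearIsometryEquiv.coe_coe,
      ContinuousLinearEquiv.coe_coe, LinearIsometryEquiv.apply_symm_apply] at h1
    have h2 := congrArg P h1
    simpa using h2
  -- the shell is the translate of `v₀`
  have hshell : sepShellL H Y x₀ = fun x => v₀ (x + -x₀) := by
    have e0 : (fun x : E3 => (H ‖x - x₀‖ * Y (x - x₀)) • (x - x₀)) = fun x => G₀ (x + -x₀) := by
      funext x
      simp only [hG₀, ← sub_eq_add_neg, hHh _ (norm_nonneg _)]
    unfold sepShellL
    rw [e0]
    have e1 : curl (fun x => G₀ (x + -x₀)) = fun x => curl G₀ (x + -x₀) := funext fun x => curl_comp_add_const G₀ (-x₀) x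
    rw [e1]
    exact funext fun x => curl_comp_add_const (curl G₀) (-x₀) x
  -- the generator
  refine ⟨(P : E3 →L[ℝ] E3).comp (rotGenL.comp (P.symm : E3 →L[ℝ] E3)), fun x => ?_, ?_, fun x => ?_⟩
  · have e1 : ((P : E3 →L[ℝ] E3).comp (rotGenL.comp (P.symm : E3 →L[ℝ] E3))) x = P (rotGen (P.symm x)) := rfl
    rw [e1]
    calc ⟪P (rotGen (P.symm x)), x⟫_ℝ = ⟪P (rotGen (P.symm x)), P (P.symm x)⟫_ℝ := by
          rw [LinearIsometryEquiv.apply_symm_apply]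
      _ = ⟪rotGen (P.symm x), P.symm x⟫_ℝ := LinearIsometryEquiv.inner_map_map P _ _
      _ = 0 := inner_rotGen_self_zero _
  · intro h0
    have h1 : P (rotGen (EuclideanSpace.single (0 : Fin 3) (1:ℝ))) = 0 := by
      have := congrArg (fun B : E3 →L[ℝ] E3 => B (P (EuclideanSpace.single (0 : Fin 3) (1:ℝ)))) h0
      simpa using this
    have h2 : rotGen (EuclideanSpace.single (0 : Fin 3) (1:ℝ)) = 0 := P.injective (by rw [h1, map_zero])
    have h3 := congrArg (fun v : E3 => v 1) h2
    simp at h3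
  · have e1 : ((P : E3 →L[ℝ] E3).comp (rotGenL.comp (P.symm : E3 →L[ℝ] E3))) (x - x₀) = P (rotGen (P.symm (x - x₀))) := rfl
    rw [e1, hshell, fderiv_comp_add_right, ← sub_eq_add_neg, hinf (x - x₀)]
    simp [sub_eq_add_neg]

end Summit.NavierStokesRegularity.NavierStokesRegularity.Theorems.UnthreadedRigidity.VirialHorn
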